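import Literature.Computability.MetaComplexity.SmolenskyCorrelation
import HarnessLib

/-!
# Smolensky's correlation bounds, II: substitutions of variables, even length, prefix parities

Continuation of `SmolenskyCorrelation.lean`. The degree filtration `lowDeg F n D` (multilinear
polynomials of degree `≤ D` on the cube `{0,1}ⁿ`, `SmolenskyProperty.lean`) is closed under
SUBSTITUTIONS OF VARIABLES — precomposition with any map of cubes `e : {0,1}ᵏ → {0,1}ⁿ` each of
whose coordinates is a constant or a variable (Jukna 2012, §2.1: on the Boolean domain `xᵢᵏ = xᵢ`,
so a monomial `X_S` becomes a constant times a monomial `X_{S'}` with `|S'| ≤ |S|`). Restricting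
the last `t` variables of a polynomial (`x = Fin.append u a`) is such a substitution, and summing
the odd-length bound `parity_agreement_le` over the `2ᵗ` fibres gives:

* `comp_subst_mem_lowDeg` — the substitution lemma;
* `parity_agreement_le_append` — on `{0,1}^{k+t}`, `k` odd, `2 ≠ 0`: a polynomial function of
  degree `≤ D` agrees with the `0/1` indicator of the FULL parity on at most
  `2ᵗ · (2ᵏ⁻¹ + D·C(k, k/2))` points;
* `parity_agreement_le'` — the bound of `parity_agreement_le`, `2ⁿ⁻¹ + D·C(n, n/2)`, for EVERY
  `n` (for even `n = k + 1` use `t = 1` and `2·C(k, k/2) = C(k+1, (k+1)/2)`);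
* `parityPrefix_agreement_le_append` — for every `k`: the parity of the FIRST `k` of `k + t`
  coordinates (a "block" parity, the other `t` coordinates free): `2ᵗ · (2ᵏ⁻¹ + D·C(k, k/2))`;
* `paritySubset_agreement_le` — the parity `⊕_{i ∈ T} xᵢ` of an ARBITRARY set `T` of coordinates
  of `{0,1}ᴺ`: at most `2^{|Tᶜ|} · (2^{|T|-1} + D·C(|T|, |T|/2))` agreements (permute `T` to the
  front with `comp_subst_mem_lowDeg`);
* `parity_correlation_bound'` — hence the circuit-level bound of `parity_correlation_bound`
  (PARITY versus `AC⁰[p]` circuits, `p` odd) for every input length `n`: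
  `|{x | C(x) = PARITY(x)}|·p^ℓ ≤ (2ⁿ⁻¹ + ((p-1)ℓ)^d·C(n,n/2))·p^ℓ + size(C)·2ⁿ`
  (Grewal–Kumar 2024, Thm. 4.2 at `k = 1`).

Deliberately NOT here: majority at even length; the circuit-level versions of the block/subset
bounds (combine with `razborov_smolensky_postprocess` exactly as in `parity_correlation_bound'`).

## References

* S. Jukna, *Boolean Function Complexity*, Springer 2012, §2.1 (multilinear polynomials on the
  Boolean cube, `xᵢᵏ = xᵢ`) [JuknaBFC2012].
* R. Smolensky, *Algebraic methods in the theory of lower bounds for Boolean circuit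
  complexity*, STOC 1987, Thm. 1 [Smolensky1987].
* S. Grewal, V. M. Kumar, *Improved circuit lower bounds and quantum-classical separations*,
  arXiv:2408.16406 (2024), Prop. 4.1, Thm. 4.2 [GrewalKumar2024].
-/

noncomputable section

namespace Literature.Computability.MetaComplexity

open Finset Module Literature.Computability.Complexity

namespace Smolensky

open scoped Classical

variable {F : Type*} [Field F] {n : ℕ}

/-! ### Substitutions of variables preserve the degree filtration -/

/-- **Substitution lemma** (Jukna 2012, §2.1: multilinear monomials on the Boolean cube,
`xᵢᵏ = xᵢ`): if every coordinate of a map of cubes `e : {0,1}ᵏ → {0,1}ⁿ` is either a constant or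
one of the `k` variables, then `P ↦ P ∘ e` maps `lowDeg F n D` into `lowDeg F k D` (a monomial
`X_S` goes to `0` or to the monomial of the variables substituted into `S`, of degree `≤ |S|`).
Covers restrictions (fixing variables), permutations and identifications of variables.
[cite: JuknaBFC2012, §2.1] -/
theorem comp_subst_mem_lowDeg {k : ℕ} (e : (Fin k → Bool) → (Fin n → Bool))
    (he : ∀ i, (∃ b, ∀ x, e x i = b) ∨ (∃ j, ∀ x, e x i = x j)) {D : ℕ} {P : CubeFn F n}
    (hP : P ∈ lowDeg F n D) : (fun x => P (e x)) ∈ lowDeg F k D := by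
  -- the degenerate case `k = 0`: the cube `{0,1}⁰` is a point, every function on it is constant
  rcases isEmpty_or_nonempty (Fin k) with hk | hk
  · have hconst : (fun x => P (e x)) = P (e fun i => isEmptyElim i) • (1 : CubeFn F k) := by
      funext x
      have hx : x = fun i => isEmptyElim i := funext fun i => isEmptyElim i
      rw [hx, Pi.smul_apply, Pi.one_apply, smul_eq_mul, mul_one]
    rw [hconst]
    exact Submodule.smul_mem _ _ (one_mem_lowDeg D)
  rw [lowDeg_eq_span] at hP
  induction hP using Submodule.span_induction with
  | mem Q hQ =>
    obtain ⟨⟨S, hS⟩, rfl⟩ := hQ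
    dsimp only
    -- split `S` into the constant coordinates and the variable coordinates
    set Sv : Finset (Fin n) := S.filter fun i => ¬ ∃ b, ∀ x, e x i = b with hSv
    have hvar : ∀ i ∈ Sv, ∃ j, ∀ x, e x i = x j := by
      intro i hi
      rw [hSv, Finset.mem_filter] at hi
      exact (he i).resolve_left hi.2
    choose! jv hjv using hvar
    by_cases hconst : ∀ i ∈ S, (∃ b, ∀ x, e x i = b) → ∀ x, e x i = true
    · -- all constant coordinates in `S` are `1`: the composite is the monomial of `jv '' Sv`
      have heq : (fun x => mono F S (e x)) = mono F (Sv.image jv) := by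
        funext x
        rw [mono_apply, mono_apply]
        have hiff : (∀ i ∈ S, e x i = true) ↔ ∀ j ∈ Sv.image jv, x j = true := by
          rw [Finset.forall_mem_image]
          constructor
          · intro h i hi
            rw [← hjv i hi x]
            exact h i (Finset.mem_of_mem_filter i (by rw [hSv] at hi; exact hi))
          · intro h i hi
            by_cases hc : ∃ b, ∀ x, e x i = b
            · exact hconst i hi hc x
            · have hi' : i ∈ Sv := by
                rw [hSv, Finset.mem_filter]; exact ⟨hi, hc⟩
              rw [hjv i hi' x]
              exact h hi'
        by_cases h : ∀ i ∈ S, e x i = true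
        · rw [if_pos h, if_pos (hiff.1 h)]
        · rw [if_neg h, if_neg fun h' => h (hiff.2 h')]
      rw [heq]
      refine mono_mem_lowDeg (Finset.card_image_le.trans ((Finset.card_filter_le _ _).trans hS))
    · -- some constant coordinate in `S` is `0`: the composite vanishes
      push Not at hconst
      obtain ⟨i, hi, ⟨b, hb⟩, x₀, hx₀⟩ := hconst
      have hbf : b = false := by
        have := hb x₀
        rw [this] at hx₀
        exact Bool.eq_false_iff.2 hx₀
      have heq : (fun x => mono F S (e x)) = 0 := by
        funext x
        rw [mono_apply, Pi.zero_apply, if_neg]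
        intro h
        have := h i hi
        rw [hb x, hbf] at this
        exact Bool.false_ne_true this
      rw [heq]
      exact Submodule.zero_mem _
  | zero => exact Submodule.zero_mem _
  | add Q R _ _ hQ hR =>
    have h : (fun x => (Q + R) (e x)) = (fun x => Q (e x)) + fun x => R (e x) := by
      funext x; rfl
    rw [h]
    exact Submodule.add_mem _ hQ hR
  | smul a Q _ hQ =>
    have h : (fun x => (a • Q) (e x)) = a • fun x => Q (e x) := by
      funext x; rfl
    rw [h]
    exact Submodule.smul_mem _ _ hQ

/-- Appending constants `a` to the input, `u ↦ Fin.append u a`, is a substitution of variables,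
so `P ↦ (u ↦ P (Fin.append u a))` maps `lowDeg F (k+t) D` into `lowDeg F k D` (restriction of
the last `t` variables). [cite: JuknaBFC2012, §2.1] -/
theorem comp_append_mem_lowDeg {k t D : ℕ} {P : CubeFn F (k + t)} (hP : P ∈ lowDeg F (k + t) D)
    (a : Fin t → Bool) : (fun u : Fin k → Bool => P (Fin.append u a)) ∈ lowDeg F k D := by
  refine comp_subst_mem_lowDeg (fun u => Fin.append u a) (fun i => ?_) hP
  induction i using Fin.addCases with
  | left j => exact Or.inr ⟨j, fun u => by rw [Fin.append_left]⟩
  | right j => exact Or.inl ⟨a j, fun u => by rw [Fin.append_right]⟩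

/-! ### Counting over the fibres of `Fin.append` -/

/-- Counting on `{0,1}^{k+t}` fibrewise over the last `t` coordinates:
`|{x | Q x}| = Σ_a |{u | Q (Fin.append u a)}|`. [folklore] -/
private theorem card_filter_eq_sum_append {k t : ℕ} (Q : (Fin (k + t) → Bool) → Prop) :
    (univ.filter fun x => Q x).card =
      ∑ a : Fin t → Bool, (univ.filter fun u : Fin k → Bool => Q (Fin.append u a)).card := by
  have h1 : (univ.filter fun x => Q x).card =
      (univ.filter fun z : (Fin k → Bool) × (Fin t → Bool) => Q (Fin.append z.1 z.2)).card := by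
    refine (Finset.card_bij (fun z _ => Fin.append z.1 z.2) (fun z hz => ?_) (fun z _ w _ h => ?_)
      (fun x hx => ?_)).symm
    · simpa using hz
    · exact (Fin.appendEquiv k t).injective h
    · refine ⟨(Fin.appendEquiv k t).symm x, ?_, (Fin.appendEquiv k t).apply_symm_apply x⟩
      have hx' : Q x := by simpa using hx
      have : Q (Fin.append ((Fin.appendEquiv k t).symm x).1 ((Fin.appendEquiv k t).symm x).2) := by
        have h := (Fin.appendEquiv k t).apply_symm_apply x
        simp only [Fin.appendEquiv, Equiv.coe_fn_mk] at h ⊢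
        rw [h]; exact hx'
      simpa using this
  rw [h1, Finset.card_filter, ← Finset.univ_product_univ, Finset.sum_product_right]
  refine Finset.sum_congr rfl fun a _ => ?_
  rw [Finset.card_filter]

/-- `numOnes` is additive over `Fin.append`. [folklore] -/
private theorem numOnes_append {k t : ℕ} (u : Fin k → Bool) (a : Fin t → Bool) :
    GateFn.numOnes (Fin.append u a) = GateFn.numOnes u + GateFn.numOnes a := by
  simp only [GateFn.numOnes, Finset.card_filter]
  rw [Fin.sum_univ_add]
  simp

/-- The parity of `Fin.append u a` is the XOR of the parities. [folklore] -/
private theorem parityFn_append {k t : ℕ} (u : Fin k → Bool) (a : Fin t → Bool) :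
    parityFn (k + t) (Fin.append u a) = xor (parityFn k u) (parityFn t a) := by
  simp only [parityFn, numOnes_append]
  rcases Nat.mod_two_eq_zero_or_one (GateFn.numOnes u) with hu | hu <;>
    rcases Nat.mod_two_eq_zero_or_one (GateFn.numOnes a) with ha | ha <;>
    simp [Nat.add_mod, hu, ha]

/-- For `k` odd and `2 ≠ 0`: a polynomial function of degree `≤ D` on `{0,1}ᵏ` agrees with
`[PARITY ⊕ c]`, `c` a constant bit, on at most `2ᵏ⁻¹ + D·C(k, k/2)` points (for `c = 1` apply
`parity_agreement_le` to `1 - Q`). [cite: Smolensky1987, Thm. 1 (proof)] -/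
theorem parity_xor_agreement_le {k : ℕ} (hk : Odd k) (h2 : (2 : F) ≠ 0) {D : ℕ} {Q : CubeFn F k}
    (hQ : Q ∈ lowDeg F k D) (c : Bool) :
    (univ.filter fun u => Q u = if xor (parityFn k u) c then 1 else 0).card ≤
      2 ^ (k - 1) + D * k.choose (k / 2) := by
  cases c with
  | false =>
    have h := parity_agreement_le hk h2 hQ
    simpa using h
  | true =>
    have h := parity_agreement_le hk h2 (Submodule.sub_mem _ (one_mem_lowDeg D) hQ)
    refine le_trans (le_of_eq ?_) h
    congr 1
    refine Finset.filter_congr fun u _ => ?_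
    simp only [Bool.xor_true, Pi.sub_apply, Pi.one_apply]
    cases parityFn k u with
    | false => simp [sub_eq_iff_eq_add]; exact eq_comm
    | true => simp

/-- **Full parity on `{0,1}^{k+t}`, `k` odd** (Smolensky 1987, Thm. 1, average-case form;
Grewal–Kumar 2024, Prop. 4.1): over a field with `2 ≠ 0`, a polynomial function `P` of degree
`≤ D` in `k + t` variables agrees with the `0/1` indicator of PARITY on at most
`2ᵗ · (2ᵏ⁻¹ + D·C(k, k/2))` points — restrict the last `t` variables (`comp_append_mem_lowDeg`)
and apply the odd-length bound in each of the `2ᵗ` fibres (`parity_xor_agreement_le`).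
[cite: Smolensky1987, Thm. 1 (proof)] -/
theorem parity_agreement_le_append {k t : ℕ} (hk : Odd k) (h2 : (2 : F) ≠ 0) {D : ℕ}
    {P : CubeFn F (k + t)} (hP : P ∈ lowDeg F (k + t) D) :
    (univ.filter fun x => P x = if parityFn (k + t) x then 1 else 0).card ≤
      2 ^ t * (2 ^ (k - 1) + D * k.choose (k / 2)) := by
  rw [card_filter_eq_sum_append (fun x => P x = if parityFn (k + t) x then 1 else 0)]
  calc ∑ a : Fin t → Bool,
        (univ.filter fun u : Fin k → Bool =>
          P (Fin.append u a) = if parityFn (k + t) (Fin.append u a) then 1 else 0).card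
      ≤ ∑ _a : Fin t → Bool, (2 ^ (k - 1) + D * k.choose (k / 2)) :=
        Finset.sum_le_sum fun a _ => by
          have h := parity_xor_agreement_le hk h2 (comp_append_mem_lowDeg hP a) (parityFn t a)
          refine le_trans (le_of_eq ?_) h
          congr 1
          refine Finset.filter_congr fun u _ => ?_
          rw [parityFn_append]
    _ = 2 ^ t * (2 ^ (k - 1) + D * k.choose (k / 2)) := by
        rw [Finset.sum_const, Finset.card_univ, smul_eq_mul]
        simp

/-! ### Every input length -/

/-- `2·C(2m+1, m) = C(2m+2, m+1)` (Pascal's rule with the symmetry `C(2m+1, m) = C(2m+1, m+1)`).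
[folklore] -/
private theorem two_mul_choose_half_odd (m : ℕ) :
    2 * (2 * m + 1).choose m = (2 * m + 2).choose (m + 1) := by
  rw [show 2 * m + 2 = (2 * m + 1) + 1 by ring, Nat.choose_succ_succ, Nat.choose_symm_half, two_mul]

/-- **Correlation of low-degree polynomials with PARITY, every length** (Smolensky 1987, Thm. 1,
average-case form; Grewal–Kumar 2024, Prop. 4.1): over a field with `2 ≠ 0`, for EVERY `n`, a
polynomial function of degree `≤ D` agrees with the `0/1` indicator of PARITY on at most
`2ⁿ⁻¹ + D·C(n, n/2)` points of `{0,1}ⁿ` (odd `n`: `parity_agreement_le`; even `n = k + 1`: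
`parity_agreement_le_append` with `t = 1` and `2·C(k, k/2) = C(n, n/2)`; `n = 0`: trivial).
[cite: Smolensky1987, Thm. 1 (proof)] -/
theorem parity_agreement_le' (h2 : (2 : F) ≠ 0) {D : ℕ} {P : CubeFn F n}
    (hP : P ∈ lowDeg F n D) :
    (univ.filter fun x => P x = if parityFn n x then 1 else 0).card ≤
      2 ^ (n - 1) + D * n.choose (n / 2) := by
  rcases Nat.even_or_odd n with hn | hn
  · obtain ⟨m, hm⟩ := hn
    cases m with
    | zero =>
      subst hm
      refine (Finset.card_le_univ _).trans ?_
      simp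
    | succ m =>
      -- `n = (2m+1) + 1`
      have hn' : n = (2 * m + 1) + 1 := by omega
      subst hn'
      have h := parity_agreement_le_append (k := 2 * m + 1) (t := 1) ⟨m, rfl⟩ h2 hP
      refine h.trans (le_of_eq ?_)
      have hk : (2 * m + 1) / 2 = m := by omega
      have hn2 : (2 * m + 1 + 1) / 2 = m + 1 := by omega
      have h1 : 2 * m + 1 - 1 = 2 * m := by omega
      have h3 : 2 * m + 1 + 1 - 1 = 2 * m + 1 := by omega
      have hc : (2 * m + 1 + 1).choose (m + 1) = 2 * (2 * m + 1).choose m := by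
        rw [show 2 * m + 1 + 1 = 2 * m + 2 by ring, ← two_mul_choose_half_odd m]
      rw [hk, hn2, h1, h3, hc]
      ring
  · exact parity_agreement_le hn h2 hP

/-! ### Block parities -/

/-- **Prefix (block) parity on `{0,1}^{k+t}`, every `k`** (Smolensky 1987, Thm. 1, average-case
form): over a field with `2 ≠ 0`, a polynomial function `P` of degree `≤ D` in `k + t` variables
agrees with the `0/1` indicator of the parity of the FIRST `k` coordinates (the remaining `t`
coordinates free) on at most `2ᵗ · (2ᵏ⁻¹ + D·C(k, k/2))` points (restrict the last `t`
variables and apply `parity_agreement_le'` in each fibre).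
[cite: Smolensky1987, Thm. 1 (proof)] -/
theorem parityPrefix_agreement_le_append {k t : ℕ} (h2 : (2 : F) ≠ 0) {D : ℕ}
    {P : CubeFn F (k + t)} (hP : P ∈ lowDeg F (k + t) D) :
    (univ.filter fun x =>
        P x = if parityFn k (fun i => x (Fin.castAdd t i)) then 1 else 0).card ≤
      2 ^ t * (2 ^ (k - 1) + D * k.choose (k / 2)) := by
  rw [card_filter_eq_sum_append
    (fun x => P x = if parityFn k (fun i => x (Fin.castAdd t i)) then 1 else 0)]
  calc ∑ a : Fin t → Bool,
        (univ.filter fun u : Fin k → Bool =>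
          P (Fin.append u a) =
            if parityFn k (fun i => Fin.append u a (Fin.castAdd t i)) then 1 else 0).card
      ≤ ∑ _a : Fin t → Bool, (2 ^ (k - 1) + D * k.choose (k / 2)) :=
        Finset.sum_le_sum fun a _ => by
          have h := parity_agreement_le' h2 (comp_append_mem_lowDeg hP a)
          refine le_trans (le_of_eq ?_) h
          congr 1
          refine Finset.filter_congr fun u _ => ?_
          simp only [Fin.append_left]
    _ = 2 ^ t * (2 ^ (k - 1) + D * k.choose (k / 2)) := by
        rw [Finset.sum_const, Finset.card_univ, smul_eq_mul]
        simp

/-! ### Parities of an arbitrary set of coordinates -/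

/-- Transport of a count along a bijection. [folklore] -/
private theorem card_filter_comp_equiv {α β : Type*} [Fintype α] [Fintype β] (e : α ≃ β)
    (Q : β → Prop) :
    (univ.filter fun a => Q (e a)).card = (univ.filter fun b => Q b).card := by
  refine Finset.card_bij (fun a _ => e a) (fun a ha => by simpa using ha)
    (fun a _ b _ h => e.injective h) (fun b hb => ⟨e.symm b, by simpa using hb, e.apply_symm_apply b⟩)

/-- **Parity of an arbitrary set `T` of coordinates** (Smolensky 1987, Thm. 1, average-case
form, after a permutation of the variables): over a field with `2 ≠ 0`, a polynomial function
`Q` of degree `≤ D` on `{0,1}ᴺ` agrees with the `0/1` indicator of `⊕_{i ∈ T} xᵢ` (any `T`) on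
at most `2^{|Tᶜ|} · (2^{|T|-1} + D·C(|T|, |T|/2))` points (reindex so that `T` comes first —
`comp_subst_mem_lowDeg` along a permutation — then `parityPrefix_agreement_le_append`).
[cite: Smolensky1987, Thm. 1 (proof)] -/
theorem paritySubset_agreement_le {N : ℕ} (T : Finset (Fin N)) (h2 : (2 : F) ≠ 0) {D : ℕ}
    {Q : CubeFn F N} (hQ : Q ∈ lowDeg F N D) :
    (univ.filter fun x : Fin N → Bool =>
        Q x = if (T.filter fun i => x i = true).card % 2 = 1 then 1 else 0).card ≤
      2 ^ Tᶜ.card * (2 ^ (T.card - 1) + D * T.card.choose (T.card / 2)) := by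
  set k := T.card with hk
  set t := Tᶜ.card with ht
  -- a permutation `σ : Fin (k + t) ≃ Fin N` listing `T` first
  have eTc' : {i // i ∈ Tᶜ} ≃ {i // ¬ i ∈ T} :=
    Equiv.subtypeEquivRight fun i => by rw [Finset.mem_compl]
  set σ : Fin (k + t) ≃ Fin N := finSumFinEquiv.symm.trans
    ((T.equivFin.symm.sumCongr (Tᶜ.equivFin.symm.trans eTc')).trans (Equiv.sumCompl fun i => i ∈ T))
    with hσ
  have hσl : ∀ j : Fin k, σ (Fin.castAdd t j) ∈ T := by
    intro j
    simp only [hσ, Equiv.trans_apply, finSumFinEquiv_symm_apply_castAdd, Equiv.sumCongr_apply,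
      Sum.map_inl, Equiv.sumCompl_apply_inl]
    exact (T.equivFin.symm j).2
  have hσr : ∀ j : Fin t, σ (Fin.natAdd k j) ∉ T := by
    intro j
    simp only [hσ, Equiv.trans_apply, finSumFinEquiv_symm_apply_natAdd, Equiv.sumCongr_apply,
      Sum.map_inr, Equiv.sumCompl_apply_inr]
    exact ((Tᶜ.equivFin.symm.trans eTc') j).2
  -- the substitution of variables `E y = y ∘ σ⁻¹`, a bijection of cubes
  set E : (Fin (k + t) → Bool) ≃ (Fin N → Bool) := σ.arrowCongr (Equiv.refl Bool) with hEdef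
  have hEapp : ∀ y i, E y i = y (σ.symm i) := fun y i => rfl
  have hE : (fun y => Q (E y)) ∈ lowDeg F (k + t) D :=
    comp_subst_mem_lowDeg (fun y => E y) (fun i => Or.inr ⟨σ.symm i, fun y => hEapp y i⟩) hQ
  -- every element of `T` is listed in the first block
  have hsurj : ∀ i ∈ T, ∃ j : Fin k, σ (Fin.castAdd t j) = i := by
    intro i hi
    obtain ⟨z, hz⟩ := σ.surjective i
    revert hz
    refine Fin.addCases (motive := fun z => σ z = i → ∃ j : Fin k, σ (Fin.castAdd t j) = i)
      (fun j hz => ⟨j, hz⟩) (fun j hz => ?_) z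
    rw [← hz] at hi
    exact absurd hi (hσr j)
  -- the `T`-parity of `E y` is the prefix parity of `y`
  have hpar : ∀ y : Fin (k + t) → Bool,
      (T.filter fun i => E y i = true).card =
        GateFn.numOnes (fun j : Fin k => y (Fin.castAdd t j)) := by
    intro y
    have hset : (T.filter fun i => E y i = true) =
        (univ.filter fun j : Fin k => y (Fin.castAdd t j) = true).image
          fun j => σ (Fin.castAdd t j) := by
      ext i
      simp only [Finset.mem_filter, Finset.mem_image, Finset.mem_univ, true_and, hEapp]
      constructor
      · rintro ⟨hiT, hiy⟩
        obtain ⟨j, hj⟩ := hsurj i hiT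
        refine ⟨j, ?_, hj⟩
        rw [← hj, Equiv.symm_apply_apply] at hiy
        exact hiy
      · rintro ⟨j, hjy, rfl⟩
        exact ⟨hσl j, by rw [Equiv.symm_apply_apply]; exact hjy⟩
    rw [hset, Finset.card_image_of_injective _
      (fun j₁ j₂ h => Fin.castAdd_injective _ _ (σ.injective h))]
    simp only [GateFn.numOnes]
  -- transport the count along `E` and conclude with the prefix bound
  rw [← card_filter_comp_equiv E
    (fun x => Q x = if (T.filter fun i => x i = true).card % 2 = 1 then (1 : F) else 0)]
  have h := parityPrefix_agreement_le_append (k := k) (t := t) h2 hE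
  refine le_trans (le_of_eq ?_) h
  congr 1
  refine Finset.filter_congr fun y _ => ?_
  rw [hpar y]
  simp only [parityFn, decide_eq_true_eq]

variable {p : ℕ} [Fact p.Prime]

/-- **Smolensky's correlation bound for PARITY against `AC⁰[p]`, `p` odd, every input length**
(Grewal–Kumar 2024, Thm. 4.2 at `k = 1`; Smolensky 1987): for an odd prime `p`, ANY `n`, a
circuit `C` over `accBasis p` of `acDepth ≤ d` and every `ℓ ≥ 1`, the agreement set
`A = {x | C(x) = PARITY(x)}` satisfies
`|A|·p^ℓ ≤ (2ⁿ⁻¹ + ((p-1)ℓ)^d·C(n, n/2))·p^ℓ + size(C)·2ⁿ` (as `parity_correlation_bound`,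
with `parity_agreement_le'` in place of the odd-length bound). [cite: GrewalKumar2024, Thm. 4.2] -/
theorem parity_correlation_bound' (hp2 : p ≠ 2) {d : ℕ} (C : Circuit (Fin n))
    (hC : C.IsOver (accBasis p)) (hd : C.acDepth ≤ d) {ℓ : ℕ} (hℓ : 1 ≤ ℓ) :
    (univ.filter fun x => C.eval x = parityFn n x).card * p ^ ℓ ≤
      (2 ^ (n - 1) + ((p - 1) * ℓ) ^ d * n.choose (n / 2)) * p ^ ℓ + C.size * 2 ^ n := by
  have hp := (Fact.out : p.Prime)
  have h2F : (2 : ZMod p) ≠ 0 := by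
    intro h
    have h' : ((2 : ℕ) : ZMod p) = 0 := by exact_mod_cast h
    rw [ZMod.natCast_eq_zero_iff] at h'
    exact hp2 ((Nat.prime_dvd_prime_iff_eq hp Nat.prime_two).1 h')
  have hM1 : 1 ≤ (p - 1) * ℓ := Nat.mul_pos (by have := hp.two_le; omega) hℓ
  obtain ⟨P, E, hP, hE, hPE⟩ := razborov_smolensky C hC hℓ
  have hagree : (univ.filter fun x => P x = if parityFn n x then 1 else 0).card ≤
      2 ^ (n - 1) + ((p - 1) * ℓ) ^ d * n.choose (n / 2) := by
    convert parity_agreement_le' h2F (lowDeg_mono (Nat.pow_le_pow_right hM1 hd) hP)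
  have hsub : (univ.filter fun x => C.eval x = parityFn n x) ⊆
      (univ.filter fun x => P x = if parityFn n x then 1 else 0) ∪ E := by
    intro x hx
    simp only [Finset.mem_filter, Finset.mem_univ, true_and] at hx
    rw [Finset.mem_union, Finset.mem_filter]
    by_cases hxE : x ∈ E
    · exact Or.inr hxE
    · refine Or.inl ⟨Finset.mem_univ _, ?_⟩
      rw [hPE x hxE, hx]
      rfl
  have hcard := (Finset.card_le_card hsub).trans (Finset.card_union_le _ _)
  calc (univ.filter fun x => C.eval x = parityFn n x).card * p ^ ℓ
      ≤ ((univ.filter fun x => P x = if parityFn n x then 1 else 0).card + E.card) * p ^ ℓ :=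
        Nat.mul_le_mul_right _ hcard
    _ = (univ.filter fun x => P x = if parityFn n x then 1 else 0).card * p ^ ℓ +
          E.card * p ^ ℓ := add_mul _ _ _
    _ ≤ (2 ^ (n - 1) + ((p - 1) * ℓ) ^ d * n.choose (n / 2)) * p ^ ℓ + C.size * 2 ^ n :=
        Nat.add_le_add (Nat.mul_le_mul_right _ hagree) hE

end Smolensky

end Literature.Computability.MetaComplexity
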